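import Summits.HodgeConjecture.HodgeConjecture.Theorems.F0P3cStCharTSCuspDiscriminantNegHalf   -- ★ p852120 (this seat's lineage, g18) (D3c): `forall_exists_nhds_setLIntegral_cuspDiscriminant_neg_half_lt_top`
import Summits.HodgeConjecture.HodgeConjecture.Theorems.F0P3cStCharTSHCDCoordinatesSlice        -- ★ p852125 (F0P2-p06) (CO) FILE 2: `exists_coords_chevalleyTarget`, `exists_sq_eq_and_cusp_discr`
import Literature.NumberTheory.LocalFields.FiniteEmbeddingNormAbs                              -- ★ p852113 (LH10-p01) (NB): `normAbs_map_eq_sq_of_involution`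
import Literature.MeasureTheory.Group.LocFiniteLIntegralProductTransfer                         -- ★ p852081 (F0P3a-p07) (G-FUB): `forall_exists_nhds_setLIntegral_lt_top_iff_of_addEquiv`
import HarnessLib

/-!
# F0 · P3c · line LH6 «StCharTS» — ROAD «HC-D», brick (HC) «CUSP DOCKING ON `↥A`»: the cusp integrand `(√√|−4c³ − 27d²|_K)⁻¹` is locally `∫⁻`-finite
# at every point of the Chevalley target `A = {(c, d) | σ c = c, σ d = −d}`, for ANY additive Haar measure on `↥A`

Cell `pub/hodgecm-mathlib`, crux H413 = `stmt-HodgeConjecture-24833` (lane `--supports … --as helper`), route HCCMUnconditional; ROAD «HC-D» (holder ∕ dealer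
F0P2-p01 (g23); DEAL (HC) 2026-09-02T16:51:41Z), seat F0P3b-p01 (g19).  THEOREMS ONLY (no definition ∕ instance ∕ notation ∕ named fact ∕ `sorry`); ★-only imports.
HONEST LABEL: count-neutral; HC_CM is proved only modulo the printed citations (hLiu418 = `stmt-HodgeConjecture-24832`, h413 = `stmt-HodgeConjecture-24833`) until
rung 0 closes.  This file discharges the ONE hypothesis `hcusp` of ★ D5(i) `F0P3cStCharTSHCDRegularPoints.exists_nhds_setLIntegral_etaIota_lt_top` (F0P3-p04), token
for token, in the letters of the GLOBAL assembly (F0P3a-p07).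

## Frame (road rulings R1–R3, R3♭)
`K` a non-archimedean local field, `σ : K →+* K` with fixed field `ι F′` for a CLOSED EMBEDDING `ι : F′ →+* K` of a non-archimedean local field `F′` (`hι`, `hιr`),
a skew unit `lam` (`σ lam = −lam`), `(2 : K) ≠ 0`, `(3 : K) ≠ 0`; the Chevalley target as an ARBITRARY additive subgroup `A ≤ K × K` with
`hA : p ∈ A ↔ σ p.1 = p.1 ∧ σ p.2 = −p.2`; ANY additive Haar measure `ν` on `↥A` (Borel).  No closedness letter for `A` is needed (local compactness and second
countability of `↥A` are transported along the chart `Φ_A`).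

## Statement (HEAD `forall_exists_nhds_setLIntegral_cuspInv_lt_top`)
`∀ a₀ : ↥A, ∃ W ∈ 𝓝 a₀, ∫⁻ a in W, (↑(√(√(normAbs K (−4 · a.1³ − 27 · a.2²)))))⁻¹ ∂ν < ∞` — the `hcusp` binder of ★ D5(i) VERBATIM.
Three currencies: `…_of_chart` takes the chart `Φ : (Fin 2 → F′) ≃ₜ+ ↥A` with `↑(Φ x) = (ι x₀, lam · ι x₁)`, `ι m = lam²` (`m ≠ 0`), the norm bridge `hιn` and
`(6 : F′) ≠ 0` as letters (the (CO)-agnostic form, as GLOBAL takes `Φ₀`); `…_of_normBridge` builds the chart from ★ (CO) and keeps GLOBAL's letter `hιn`; the HEAD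
discharges `hιn` by ★ (NB) from `hσ`.

## Proof
★ (CO) `exists_coords_chevalleyTarget`: `Φ_A : (Fin 2 → F′) ≃ₜ+ ↥A`, `Φ_A x = (ι x₀, lam · ι x₁)`; ★ (CO) `exists_sq_eq_and_cusp_discr`: `lam² = ι m` and
`−4(ι x₀)³ − 27(lam · ι x₁)² = ι(−4x₀³ − 27 m x₁²)`; ★ (NB): `normAbs K (ι y) = normAbs F′ y ^ 2`, so the integrand read through `Φ_A` is
`(↑√(normAbs F′ (−4x₀³ − 27 m x₁²)))⁻¹ = (↑normAbs F′ (…))^{−1∕2}` (§1; at a zero both sides are `⊤`); ★ (D3c) with `d := m ≠ 0` (`lam ≠ 0`), `(6 : F′) ≠ 0`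
(`ι` injective) gives local finiteness on `Fin 2 → F′` for the product Haar measure; ★ (G-FUB) `forall_exists_nhds_setLIntegral_lt_top_iff_of_addEquiv Φ_A` moves it to
`↥A` for ANY Haar measure `ν` (uniqueness of Haar measure absorbs the constant).
[HarishChandra1970 Part VII §1 Thm. 15 (the cusp `|δ|^{−1∕2}` on the Chevalley quotient); WeilBNT1967 Ch. I §2 (moduli along a quadratic extension); Folland1999 §11.1
Thm. 11.9 (uniqueness of Haar measure); Rogawski1990 §4.9 p. 54 (the unitary Lie algebra in three variables and its invariants)]
-/

set_option autoImplicit false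
-- the mandated namespace has the single-problem summit's repeated segment (`HodgeConjecture.HodgeConjecture`)
set_option linter.dupNamespace false

noncomputable section

open MeasureTheory MeasureTheory.Measure Filter Topology Set
open scoped ENNReal NNReal
open Literature.NumberTheory.GaloisRepresentations Literature.NumberTheory.GaloisRepresentations.IsNonarchimedeanLocalField
open Literature.NumberTheory.Automorphic Literature.MeasureTheory.Group Literature.NumberTheory.LocalFields
open Summit.HodgeConjecture.HodgeConjecture.Cruxes.H413.F0P3cStCharTSHCDCoordinates
open Summit.HodgeConjecture.HodgeConjecture.Cruxes.H413.F0P3cStCharTSCuspDiscriminantNegHalf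

namespace Summit.HodgeConjecture.HodgeConjecture.Cruxes.H413.F0P3cStCharTSHCDCuspDocking

/-! ## §1 `ℝ≥0∞` bookkeeping: `(↑√(√(n²)))⁻¹ = (↑n)^{−1∕2}` -/

/-- `√(√(n²)) = √n` in `ℝ≥0`. [cite: Folland1999, §2.5 Thm. 2.37] -/
theorem sqrt_sqrt_sq (n : ℝ≥0) : NNReal.sqrt (NNReal.sqrt (n ^ 2)) = NNReal.sqrt n := by
  rw [NNReal.sqrt_sq]

/-- `(↑√n)⁻¹ = (↑n) ^ (−1∕2)` in `ℝ≥0∞` (at `n = 0` both sides are `⊤`). [cite: Folland1999, §2.5 Thm. 2.37] -/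
theorem coe_sqrt_inv_eq_rpow_neg_half (n : ℝ≥0) : ((NNReal.sqrt n : ℝ≥0∞))⁻¹ = (n : ℝ≥0∞) ^ (-(1 / 2 : ℝ)) := by
  rw [ENNReal.rpow_neg, NNReal.sqrt_eq_rpow, ENNReal.coe_rpow_of_nonneg _ (by norm_num : (0 : ℝ) ≤ 1 / 2)]

/-- The docking algebra in one line: if `N = n ^ 2` then `(↑√(√N))⁻¹ = (↑n) ^ (−1∕2)`. [cite: WeilBNT1967, Ch. I §2 Cor. 3 of Thm. 3] -/
theorem coe_sqrt_sqrt_inv_eq_rpow_neg_half_of_eq_sq {N n : ℝ≥0} (h : N = n ^ 2) :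
    ((NNReal.sqrt (NNReal.sqrt N) : ℝ≥0∞))⁻¹ = (n : ℝ≥0∞) ^ (-(1 / 2 : ℝ)) := by
  rw [h, sqrt_sqrt_sq, coe_sqrt_inv_eq_rpow_neg_half]

/-! ## §2 The cusp integrand read through the Chevalley-target chart `Φ_A` -/

section Frame

variable {K : Type*} [Field K] [ValuativeRel K] [TopologicalSpace K] [IsNonarchimedeanLocalField K]
  {F' : Type*} [Field F'] [ValuativeRel F'] [TopologicalSpace F'] [IsNonarchimedeanLocalField F']

/-- **The cusp integrand in coordinates.**  If `↑(Φ x) = (ι x₀, lam · ι x₁)`, `−4(ι a)³ − 27(lam · ι b)² = ι(−4a³ − 27 m b²)` and `normAbs K (ι y) = normAbs F′ y ^ 2`,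
then `(↑√(√(normAbs K (−4 (Φ x).1³ − 27 (Φ x).2²))))⁻¹ = (↑(normAbs F′ (−4x₀³ − 27 m x₁²)))^{−1∕2}`.
[cite: WeilBNT1967, Ch. I §2 Cor. 3 of Thm. 3] [cite: Rogawski1990, §4.9 p. 54] -/
theorem cuspInv_coords_eq (ι : F' →+* K) (hιn : ∀ y : F', normAbs K (ι y) = normAbs F' y ^ 2) (lam : Kˣ) {m : F'}
    (hdisc : ∀ a b : F', -4 * ι a ^ 3 - 27 * ((lam : K) * ι b) ^ 2 = ι (-4 * a ^ 3 - 27 * m * b ^ 2))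
    {A : AddSubgroup (K × K)} (Φ : (Fin 2 → F') ≃ₜ+ ↥A) (hΦ : ∀ x : Fin 2 → F', ((Φ x : ↥A) : K × K) = (ι (x 0), (lam : K) * ι (x 1)))
    (x : Fin 2 → F') :
    ((NNReal.sqrt (NNReal.sqrt (normAbs K (-4 * ((Φ x : ↥A) : K × K).1 ^ 3 - 27 * ((Φ x : ↥A) : K × K).2 ^ 2))) : ℝ≥0∞))⁻¹ =
      ((normAbs F' (-4 * x 0 ^ 3 - 27 * m * x 1 ^ 2) : ℝ≥0∞)) ^ (-(1 / 2 : ℝ)) := by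
  rw [hΦ x]
  exact coe_sqrt_sqrt_inv_eq_rpow_neg_half_of_eq_sq (by rw [hdisc, hιn])

/-! ## §3 The docking theorems -/

/-- **(HC) «CUSP DOCKING ON `↥A`», chart letters** (the (CO)-agnostic form, as GLOBAL takes `Φ₀`): given ANY continuous additive isomorphism
`Φ : (Fin 2 → F′) ≃ₜ+ ↥A` reading `↑(Φ x) = (ι x₀, lam · ι x₁)`, an element `m ≠ 0` of `F′` with `ι m = lam²`, the quadratic norm bridge `hιn`, and `(6 : F′) ≠ 0`:
for ANY additive Haar measure `ν` on `↥A`, the cusp integrand is locally `∫⁻`-finite at every point of `↥A`.  Proof: ★ (D3c) (`d := m`) on `Fin 2 → F′` + ★ (G-FUB) along `Φ`.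
[cite: HarishChandra1970, Part VII §1 Thm. 15] [cite: Folland1999, §11.1 Thm. 11.9] -/
theorem forall_exists_nhds_setLIntegral_cuspInv_lt_top_of_chart
    (ι : F' →+* K) (hιn : ∀ y : F', normAbs K (ι y) = normAbs F' y ^ 2) (lam : Kˣ)
    {m : F'} (hm : ι m = (lam : K) ^ 2) (hm0 : m ≠ 0) (h6 : (6 : F') ≠ 0)
    {A : AddSubgroup (K × K)} (Φ : (Fin 2 → F') ≃ₜ+ ↥A) (hΦ : ∀ x : Fin 2 → F', ((Φ x : ↥A) : K × K) = (ι (x 0), (lam : K) * ι (x 1)))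
    [MeasurableSpace ↥A] [BorelSpace ↥A] (ν : Measure ↥A) [ν.IsAddHaarMeasure] :
    ∀ a₀ : ↥A, ∃ W ∈ 𝓝 a₀, ∫⁻ a in W,
      ((NNReal.sqrt (NNReal.sqrt (normAbs K (-4 * (a : K × K).1 ^ 3 - 27 * (a : K × K).2 ^ 2))) : ℝ≥0∞))⁻¹ ∂ν < ∞ := by
  classical
  -- ===== instances on the coordinate field `F′` (Borel structure fixed inside the proof) =====
  haveI : T2Space F' := (isLocalField F').toT2Space
  haveI := secondCountableTopology_localField F'
  letI : MeasurableSpace F' := borel F'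
  haveI : BorelSpace F' := ⟨rfl⟩
  -- ===== instances on `↥A`, transported along `Φ` =====
  haveI : LocallyCompactSpace ↥A := Φ.toHomeomorph.symm.isClosedEmbedding.locallyCompactSpace
  haveI : SecondCountableTopology ↥A := Φ.toHomeomorph.symm.secondCountableTopology
  -- ===== a Haar measure on `F′` and the product Haar measure on `Fin 2 → F′` =====
  set μ : Measure F' := Measure.addHaar with hμ
  haveI : (Measure.pi fun _ : Fin 2 => μ).IsAddHaarMeasure := Measure.pi.isAddHaarMeasure _
  -- ===== the cusp discriminant in coordinates =====
  have hdisc : ∀ a b : F', -4 * ι a ^ 3 - 27 * ((lam : K) * ι b) ^ 2 = ι (-4 * a ^ 3 - 27 * m * b ^ 2) := fun a b => by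
    simp only [map_sub, map_mul, map_neg, map_pow, map_ofNat, hm]
    ring
  -- ===== the integrand and its coordinate reading =====
  set f : ↥A → ℝ≥0∞ := fun a =>
    ((NNReal.sqrt (NNReal.sqrt (normAbs K (-4 * (a : K × K).1 ^ 3 - 27 * (a : K × K).2 ^ 2))) : ℝ≥0∞))⁻¹ with hfdef
  have hfΦ : ∀ x : Fin 2 → F', f (Φ x) = ((normAbs F' (-4 * x 0 ^ 3 - 27 * m * x 1 ^ 2) : ℝ≥0∞)) ^ (-(1 / 2 : ℝ)) :=
    fun x => cuspInv_coords_eq ι hιn lam hdisc Φ hΦ x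
  -- ===== ★ (D3c) on the coordinate plane, ★ (G-FUB) back to `↥A` =====
  have hD3c := forall_exists_nhds_setLIntegral_cuspDiscriminant_neg_half_lt_top μ hm0 h6
  refine (forall_exists_nhds_setLIntegral_lt_top_iff_of_addEquiv Φ (Measure.pi fun _ : Fin 2 => μ) ν f).2 fun w => ?_
  obtain ⟨U, hU, hfin⟩ := hD3c w
  refine ⟨U, hU, ?_⟩
  have hcongr : ∫⁻ v in U, f (Φ v) ∂(Measure.pi fun _ : Fin 2 => μ) =
      ∫⁻ v in U, ((normAbs F' (-4 * v 0 ^ 3 - 27 * m * v 1 ^ 2) : ℝ≥0∞)) ^ (-(1 / 2 : ℝ)) ∂(Measure.pi fun _ : Fin 2 => μ) :=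
    lintegral_congr fun v => hfΦ v
  rw [hcongr]
  exact hfin

/-- **(HC) «CUSP DOCKING ON `↥A`», norm-bridge letter.**  Frame of the module docstring, with the quadratic norm bridge `hιn : normAbs K (ι x) = normAbs F′ x ^ 2`
(GLOBAL's letter; ★ (NB) discharges it) in place of `hσ`: for ANY additive Haar measure `ν` on `↥A`, every `a₀ : ↥A` has a neighbourhood `W` with
`∫⁻ a in W, (↑√(√(normAbs K (−4 a.1³ − 27 a.2²))))⁻¹ ∂ν < ∞` — the `hcusp` binder of ★ D5(i) verbatim.  Proof: ★ (CO) chart `Φ_A`, `lam² = ι m` (`m ≠ 0` as `lam ≠ 0`,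
`(6 : F′) ≠ 0` as `ι` is injective) + `…_of_chart`.
[cite: HarishChandra1970, Part VII §1 Thm. 15] [cite: Rogawski1990, §4.9 p. 54] [cite: Folland1999, §11.1 Thm. 11.9] -/
theorem forall_exists_nhds_setLIntegral_cuspInv_lt_top_of_normBridge
    (σ : K →+* K) (h2 : (2 : K) ≠ 0) (h3 : (3 : K) ≠ 0)
    (ι : F' →+* K) (hι : IsClosedEmbedding ι) (hιr : ∀ x, σ x = x ↔ x ∈ Set.range ι)
    (hιn : ∀ y : F', normAbs K (ι y) = normAbs F' y ^ 2)
    (lam : Kˣ) (hlam : σ (lam : K) = -(lam : K))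
    (A : AddSubgroup (K × K)) (hA : ∀ p : K × K, p ∈ A ↔ σ p.1 = p.1 ∧ σ p.2 = -p.2)
    [MeasurableSpace ↥A] [BorelSpace ↥A] (ν : Measure ↥A) [ν.IsAddHaarMeasure] :
    ∀ a₀ : ↥A, ∃ W ∈ 𝓝 a₀, ∫⁻ a in W,
      ((NNReal.sqrt (NNReal.sqrt (normAbs K (-4 * (a : K × K).1 ^ 3 - 27 * (a : K × K).2 ^ 2))) : ℝ≥0∞))⁻¹ ∂ν < ∞ := by
  -- ===== ★ (CO): the chart `Φ_A` and `lam² = ι m` =====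
  obtain ⟨Φ, hΦ, -⟩ := exists_coords_chevalleyTarget σ ι hι hιr lam hlam A hA
  obtain ⟨m, hm, -⟩ := exists_sq_eq_and_cusp_discr σ ι hιr lam hlam
  -- ===== constants: `m ≠ 0`, `(6 : F′) ≠ 0` =====
  have hm0 : m ≠ 0 := by
    intro h
    apply lam.ne_zero
    have h0 : (lam : K) ^ 2 = 0 := by rw [← hm, h, map_zero]
    exact pow_eq_zero_iff (two_ne_zero) |>.1 h0
  have h6 : (6 : K) ≠ 0 := by
    rw [show (6 : K) = 2 * 3 by norm_num]; exact mul_ne_zero h2 h3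
  have h6' : (6 : F') ≠ 0 := fun h => h6 (by rw [← map_ofNat ι 6, h, map_zero])
  exact forall_exists_nhds_setLIntegral_cuspInv_lt_top_of_chart ι hιn lam hm hm0 h6' Φ hΦ ν

/-- **(HC) «CUSP DOCKING ON `↥A`» — THE HEAD.**  `K`, `F′` non-archimedean local fields, `σ : K →+* K` an involution with fixed field `ι F′` (`ι` a closed embedding),
`lam` a skew unit, `(2 : K) ≠ 0`, `(3 : K) ≠ 0`, `A ≤ K × K` ANY additive subgroup with `p ∈ A ↔ σ p.1 = p.1 ∧ σ p.2 = −p.2`, `ν` ANY additive Haar measure on `↥A`: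
**`∀ a₀ : ↥A, ∃ W ∈ 𝓝 a₀, ∫⁻ a in W, (↑√(√(normAbs K (−4 a.1³ − 27 a.2²))))⁻¹ ∂ν < ∞`** — the `hcusp` input of ★ D5(i) `F0P3cStCharTSHCDRegularPoints.exists_nhds_setLIntegral_etaIota_lt_top`,
VERBATIM; the norm bridge is discharged by ★ (NB) `normAbs_map_eq_sq_of_involution`.
[cite: HarishChandra1970, Part VII §1 Thm. 15] [cite: WeilBNT1967, Ch. I §2 Cor. 3 of Thm. 3] [cite: Folland1999, §11.1 Thm. 11.9] -/
theorem forall_exists_nhds_setLIntegral_cuspInv_lt_top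
    (σ : K →+* K) (hσ : ∀ x, σ (σ x) = x) (h2 : (2 : K) ≠ 0) (h3 : (3 : K) ≠ 0)
    (ι : F' →+* K) (hι : IsClosedEmbedding ι) (hιr : ∀ x, σ x = x ↔ x ∈ Set.range ι)
    (lam : Kˣ) (hlam : σ (lam : K) = -(lam : K))
    (A : AddSubgroup (K × K)) (hA : ∀ p : K × K, p ∈ A ↔ σ p.1 = p.1 ∧ σ p.2 = -p.2)
    [MeasurableSpace ↥A] [BorelSpace ↥A] (ν : Measure ↥A) [ν.IsAddHaarMeasure] :
    ∀ a₀ : ↥A, ∃ W ∈ 𝓝 a₀, ∫⁻ a in W,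
      ((NNReal.sqrt (NNReal.sqrt (normAbs K (-4 * (a : K × K).1 ^ 3 - 27 * (a : K × K).2 ^ 2))) : ℝ≥0∞))⁻¹ ∂ν < ∞ := by
  haveI : Invertible (2 : K) := invertibleOfNonzero h2
  exact forall_exists_nhds_setLIntegral_cuspInv_lt_top_of_normBridge σ h2 h3 ι hι hιr
    (normAbs_map_eq_sq_of_involution ι hι.continuous σ hσ hιr lam hlam) lam hlam A hA ν

/-- **(HC), pointwise form** (one `a₀ : ↥A`; convenient when the consumer fixes the base point first). [cite: HarishChandra1970, Part VII §1 Thm. 15] -/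
theorem exists_nhds_setLIntegral_cuspInv_lt_top
    (σ : K →+* K) (hσ : ∀ x, σ (σ x) = x) (h2 : (2 : K) ≠ 0) (h3 : (3 : K) ≠ 0)
    (ι : F' →+* K) (hι : IsClosedEmbedding ι) (hιr : ∀ x, σ x = x ↔ x ∈ Set.range ι)
    (lam : Kˣ) (hlam : σ (lam : K) = -(lam : K))
    (A : AddSubgroup (K × K)) (hA : ∀ p : K × K, p ∈ A ↔ σ p.1 = p.1 ∧ σ p.2 = -p.2)
    [MeasurableSpace ↥A] [BorelSpace ↥A] (ν : Measure ↥A) [ν.IsAddHaarMeasure] (a₀ : ↥A) :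
    ∃ W ∈ 𝓝 a₀, ∫⁻ a in W,
      ((NNReal.sqrt (NNReal.sqrt (normAbs K (-4 * (a : K × K).1 ^ 3 - 27 * (a : K × K).2 ^ 2))) : ℝ≥0∞))⁻¹ ∂ν < ∞ :=
  forall_exists_nhds_setLIntegral_cuspInv_lt_top σ hσ h2 h3 ι hι hιr lam hlam A hA ν a₀

end Frame

end Summit.HodgeConjecture.HodgeConjecture.Cruxes.H413.F0P3cStCharTSHCDCuspDocking

end
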